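import Mathlib
import Summits.ResolutionOfSingularities.ResolutionOfSingularities.Theorems.HomologicalConductorPersistenceCyclicQuotientLocalVertex
import Literature.RingTheory.CohomologyAnnihilator.AnnihilationOfCohomologyProofs
import HarnessLib

/-!
# Rung S-2 `PersistenceSurface` (stmt-ResolutionOfSingularities-19970), stub C1 (`Sat₄`) — the cyclic quotient
# `U = k[u,v]^{(n;1,q)}` is an ISOLATED singularity: `U_𝔭` is regular at every prime `𝔭` avoiding `uⁿ` or `vⁿ`,
# the vertex is the ONLY maximal ideal containing `uⁿ` and `vⁿ`, and the local `Sat₄` theorem at the vertex is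
# UNCONDITIONAL

[OURS · cell decomp-res · rung S-2; seat leafhand-res-homologicalconduct-15 gen 0]  Nothing here is a statement of the
manuscript under review (Hironaka 2017); AI-written, weaker than expert review.  DEF-FREE.

`…PersistenceCyclicQuotientLocalVertex.saturation_cyclicQuotient_atVertex_charFree` (this seat, p822984) carried the
isolatedness of `U` off the vertex as a hypothesis `hreg`.  This file discharges it, in every characteristic, by the
cohomology annihilator itself: `uⁿ, vⁿ ∈ ca³(U)` (the engines' criterion `monomial_mem_cohomologyAnnihilatorOfDegree_three`,
every residue `a` being `a = i₁` with `i₁ ≤ n`, resp. `a = q j₁` with `j₁ ≤ n`), and a prime avoiding `ca(U)` is a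
regular point ([IyengarTakahashi2014, Lemma 2.10 (2)], tree `cohomologyAnnihilatorOfDegree_le_of_not_isRegularLocalRing`).

* `X_pow_mem` — `uⁿ, vⁿ ∈ U`; `X_zero_pow_mem_caAt_three`, `X_one_pow_mem_caAt_three` — `uⁿ, vⁿ ∈ ca³(U)`;
* `isRegularLocalRing_atPrime_of_X_zero_pow_notMem` / `…_X_one_pow_notMem` — `uⁿ ∉ 𝔭` (or `vⁿ ∉ 𝔭`) ⇒ `U_𝔭` regular;
* `mem_of_constantCoeff_eq_zero` — a prime containing `uⁿ` and `vⁿ` contains every invariant with zero constant term;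
* `eq_of_isMaximal_of_X_pow_mem` — two maximal ideals containing `uⁿ` and `vⁿ` coincide (THE vertex);
* `isRegularLocalRing_atPrime_of_ne_vertex` — `U_𝔫` is regular at every maximal `𝔫 ≠` the vertex;
* `saturation_cyclicQuotient_atVertex` — **UNCONDITIONAL**: for every maximal `𝔪 ⊆ U` containing `uⁿ` and `vⁿ`
  (`gcd(q,n) = 1`, `k` any field): `caᵐ(U_𝔪) = ca⁴(U_𝔪)` (`m ≥ 4`), `ca(U_𝔪) = ca⁴(U_𝔪) = ca⁴(U)·U_𝔪`,
  `x/1 ∈ ca(U_𝔪) ↔ x ∈ ca(U)`; and `saturation_of_ringEquiv_cyclicQuotient_vertex` for every ring `T ≃+* U_𝔪`.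

References: S. B. Iyengar, R. Takahashi, IMRN 2016, arXiv:1404.1476, Lemma 2.10 (2) [`IyengarTakahashi2014`] — used
through landed tree lemmas; folklore (toric surfaces are smooth off the fixed point).
-/

-- single-problem summit: the doubled namespace component `ResolutionOfSingularities` is forced
set_option linter.dupNamespace false

noncomputable section

open MvPolynomial Literature.RingTheory.CohomologyAnnihilator
open Summit.ResolutionOfSingularities.ResolutionOfSingularities.Theorems.HomologicalConductor.PersistenceCyclicQuotientCharFree
  (isNoetherianRing_degreeZero monomial_mem_cohomologyAnnihilatorOfDegree_three)
open Summit.ResolutionOfSingularities.ResolutionOfSingularities.Theorems.HomologicalConductor.PersistenceCyclicQuotientGradedPieces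
  (whc_zero_monomial_of_dvd whc_eq_self_iff whc_monomial)
open Summit.ResolutionOfSingularities.ResolutionOfSingularities.Theorems.HomologicalConductor.PersistenceCyclicQuotientLocalVertex

universe u

namespace Summit.ResolutionOfSingularities.ResolutionOfSingularities.Theorems.HomologicalConductor.PersistenceCyclicQuotientVertexIsolated

variable {k : Type u} [Field k] {n : ℕ} [NeZero n] {q : ℕ} (U : Subalgebra k (MvPolynomial (Fin 2) k))
variable (hU : ∀ p, p ∈ U ↔ weightedHomogeneousComponent (![1, (q : ZMod n)] : Fin 2 → ZMod n) 0 p = p)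

/-! ## `uⁿ`, `vⁿ` and the constants lie in `U`; `uⁿ, vⁿ ∈ ca³(U)` -/

omit [NeZero n] in
include hU in
/-- `(X i)ⁿ ∈ U` (all exponents divisible by `n`). [folklore] -/
theorem X_pow_mem (i : Fin 2) : (X i : MvPolynomial (Fin 2) k) ^ n ∈ U := by
  rw [X_pow_eq_monomial]
  refine (hU _).mpr (whc_zero_monomial_of_dvd q _ _ ?_ ?_) <;>
  · rw [Finsupp.single_apply]
    split_ifs <;> simp

omit [NeZero n] in
include hU in
/-- Constants lie in `U`. [folklore] -/
theorem C_mem (c : k) : (C c : MvPolynomial (Fin 2) k) ∈ U := by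
  rw [C_apply]
  exact (hU _).mpr (whc_zero_monomial_of_dvd q 0 c (by simp) (by simp))

include hU in
/-- **`uⁿ ∈ ca³(U)`**: every residue `a` mod `n` is `a = i₁ + q·0` with `i₁ = a.val ≤ n` (engines' criterion).
[OURS · cell decomp-res] -/
theorem X_zero_pow_mem_caAt_three (hq : q.Coprime n) :
    (⟨(X 0 : MvPolynomial (Fin 2) k) ^ n, X_pow_mem U hU 0⟩ : U) ∈ cohomologyAnnihilatorOfDegree U 3 := by
  have hmem : ((X 0 : MvPolynomial (Fin 2) k) ^ n * X 1 ^ 0) ∈ U := by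
    rw [pow_zero, mul_one]; exact X_pow_mem U hU 0
  have h := monomial_mem_cohomologyAnnihilatorOfDegree_three (k := k) (n := n) hq U hU n 0 hmem fun a =>
    ⟨a.val, 0, (ZMod.val_lt a).le, le_rfl, by rw [mul_zero, add_zero, ZMod.natCast_zmod_val]⟩
  convert h using 2
  rw [pow_zero, mul_one]

include hU in
/-- **`vⁿ ∈ ca³(U)`**: every residue `a` mod `n` is `a = 0 + q j₁` with `j₁ = (a q⁻¹).val ≤ n` (`gcd(q,n) = 1`).
[OURS · cell decomp-res] -/
theorem X_one_pow_mem_caAt_three (hq : q.Coprime n) :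
    (⟨(X 1 : MvPolynomial (Fin 2) k) ^ n, X_pow_mem U hU 1⟩ : U) ∈ cohomologyAnnihilatorOfDegree U 3 := by
  have hmem : ((X 0 : MvPolynomial (Fin 2) k) ^ 0 * X 1 ^ n) ∈ U := by
    rw [pow_zero, one_mul]; exact X_pow_mem U hU 1
  let qu : (ZMod n)ˣ := ZMod.unitOfCoprime q hq
  have h := monomial_mem_cohomologyAnnihilatorOfDegree_three (k := k) (n := n) hq U hU 0 n hmem fun a =>
    ⟨0, (a * (qu⁻¹ : (ZMod n)ˣ)).val, le_rfl, (ZMod.val_lt _).le, by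
      rw [zero_add, Nat.cast_mul, ZMod.natCast_zmod_val,
        show ((q : ℕ) : ZMod n) = (qu : ZMod n) from (ZMod.coe_unitOfCoprime q hq).symm]
      rw [mul_comm, Units.inv_mul_cancel_right]⟩
  convert h using 2
  rw [pow_zero, one_mul]

/-! ## Regularity off `uⁿ = vⁿ = 0` -/

include hU in
/-- **`U_𝔭` is regular at every prime `𝔭 ∌ uⁿ`**: `uⁿ ∈ ca³(U) ⊄ 𝔭`, and a prime not containing `ca³` is a regular
point ([IyengarTakahashi2014, Lemma 2.10 (2)]). [cite: IyengarTakahashi2014, Lemma 2.10 (2)] -/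
theorem isRegularLocalRing_atPrime_of_X_zero_pow_notMem (hq : q.Coprime n) (𝔭 : Ideal U) [𝔭.IsPrime]
    (h : (⟨(X 0 : MvPolynomial (Fin 2) k) ^ n, X_pow_mem U hU 0⟩ : U) ∉ 𝔭) :
    IsRegularLocalRing (Localization.AtPrime 𝔭) := by
  haveI : IsNoetherianRing U := isNoetherianRing_degreeZero (k := k) (n := n) q U hU
  by_contra hreg
  exact h (cohomologyAnnihilatorOfDegree_le_of_not_isRegularLocalRing 𝔭 hreg 3 (X_zero_pow_mem_caAt_three U hU hq))

include hU in
/-- **`U_𝔭` is regular at every prime `𝔭 ∌ vⁿ`.** [cite: IyengarTakahashi2014, Lemma 2.10 (2)] -/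
theorem isRegularLocalRing_atPrime_of_X_one_pow_notMem (hq : q.Coprime n) (𝔭 : Ideal U) [𝔭.IsPrime]
    (h : (⟨(X 1 : MvPolynomial (Fin 2) k) ^ n, X_pow_mem U hU 1⟩ : U) ∉ 𝔭) :
    IsRegularLocalRing (Localization.AtPrime 𝔭) := by
  haveI : IsNoetherianRing U := isNoetherianRing_degreeZero (k := k) (n := n) q U hU
  by_contra hreg
  exact h (cohomologyAnnihilatorOfDegree_le_of_not_isRegularLocalRing 𝔭 hreg 3 (X_one_pow_mem_caAt_three U hU hq))

/-! ## The vertex is the only maximal ideal containing `uⁿ` and `vⁿ` -/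

include hU in
/-- **A prime of `U` containing `uⁿ` and `vⁿ` contains every invariant with zero constant term.**  An invariant `x` is
the sum of its monomials `c·u^{d₀}v^{d₁}`, each invariant (weight criterion); for `d ≠ 0` the invariant monomial
`m = u^{d₀}v^{d₁}` has `mⁿ = (uⁿ)^{d₀}(vⁿ)^{d₁} ∈ 𝔭`, so `m ∈ 𝔭`. [folklore] -/
theorem mem_of_constantCoeff_eq_zero (𝔭 : Ideal U) [𝔭.IsPrime]
    (hu : (⟨(X 0 : MvPolynomial (Fin 2) k) ^ n, X_pow_mem U hU 0⟩ : U) ∈ 𝔭)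
    (hv : (⟨(X 1 : MvPolynomial (Fin 2) k) ^ n, X_pow_mem U hU 1⟩ : U) ∈ 𝔭)
    (x : U) (hx : constantCoeff (x : MvPolynomial (Fin 2) k) = 0) : x ∈ 𝔭 := by
  have hnpos : 0 < n := Nat.pos_of_ne_zero (NeZero.ne n)
  -- every monomial of an invariant is invariant
  have hwt : ∀ d ∈ (x : MvPolynomial (Fin 2) k).support, ((d 0 + q * d 1 : ℕ) : ZMod n) = 0 :=
    (whc_eq_self_iff q 0 _).mp ((hU _).mp x.2)
  have hmon : ∀ d ∈ (x : MvPolynomial (Fin 2) k).support, ∀ c : k, monomial d c ∈ U := by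
    intro d hd c
    rw [hU, ← hwt d hd]
    exact whc_monomial q d c
  -- an invariant monomial with `d ≠ 0` lies in `𝔭`
  have hmonp : ∀ d (hd : d ∈ (x : MvPolynomial (Fin 2) k).support), d ≠ 0 →
      ∀ c : k, (⟨monomial d c, hmon d hd c⟩ : U) ∈ 𝔭 := by
    intro d hd hd0 c
    -- `c · m` with `m = monomial d 1`
    have hsplit : (⟨monomial d c, hmon d hd c⟩ : U) = ⟨C c, C_mem U hU c⟩ * ⟨monomial d 1, hmon d hd 1⟩ := by
      apply Subtype.ext
      change monomial d c = C c * monomial d 1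
      rw [C_mul_monomial, mul_one]
    rw [hsplit]
    refine Ideal.mul_mem_left _ _ (Ideal.IsPrime.mem_of_pow_mem ‹_› n ?_)
    -- `mⁿ = (uⁿ)^{d 0} · (vⁿ)^{d 1}`
    have hpow : (⟨monomial d 1, hmon d hd 1⟩ : U) ^ n =
        (⟨(X 0 : MvPolynomial (Fin 2) k) ^ n, X_pow_mem U hU 0⟩ : U) ^ (d 0) *
          (⟨(X 1 : MvPolynomial (Fin 2) k) ^ n, X_pow_mem U hU 1⟩ : U) ^ (d 1) := by
      have hd : n • d = Finsupp.single 0 (n * d 0) + Finsupp.single 1 (n * d 1) := by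
        ext i; fin_cases i <;> simp
      apply Subtype.ext
      change (monomial d (1 : k)) ^ n = ((X 0 : MvPolynomial (Fin 2) k) ^ n) ^ (d 0) * ((X 1) ^ n) ^ (d 1)
      rw [monomial_pow, one_pow, hd, ← pow_mul, ← pow_mul, X_pow_eq_monomial, X_pow_eq_monomial,
        monomial_mul, mul_one]
    rw [hpow]
    -- one of `d 0`, `d 1` is positive
    by_cases h0 : d 0 = 0
    · have h1 : d 1 ≠ 0 := by
        intro h1; apply hd0; ext i; fin_cases i <;> simp [h0, h1]
      exact Ideal.mul_mem_left _ _ (Ideal.pow_mem_of_mem _ hv _ (Nat.pos_of_ne_zero h1))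
    · exact Ideal.mul_mem_right _ _ (Ideal.pow_mem_of_mem _ hu _ (Nat.pos_of_ne_zero h0))
  -- sum over the support (`0 ∉ support` since the constant coefficient vanishes)
  have hsum : x = ∑ d ∈ (x : MvPolynomial (Fin 2) k).support.attach,
      (⟨monomial d.1 (coeff d.1 (x : MvPolynomial (Fin 2) k)), hmon d.1 d.2 _⟩ : U) := by
    apply Subtype.ext
    rw [AddSubmonoidClass.coe_finsetSum]
    rw [Finset.sum_attach (x : MvPolynomial (Fin 2) k).support
      (fun d => monomial d (coeff d (x : MvPolynomial (Fin 2) k)))]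
    exact (x : MvPolynomial (Fin 2) k).as_sum
  rw [hsum]
  refine Ideal.sum_mem _ fun d _ => hmonp d.1 d.2 ?_ _
  intro hd0
  have hmem := d.2
  rw [hd0, mem_support_iff, ← constantCoeff_eq, hx] at hmem
  exact hmem rfl

include hU in
/-- **THE vertex**: two maximal ideals of `U` containing `uⁿ` and `vⁿ` coincide (for `x ∈ 𝔫` write `x = c + xp` with
`xp` of zero constant term, in both by `mem_of_constantCoeff_eq_zero`; a non-zero constant `c ∈ 𝔫` would be a unit).
[folklore] -/
theorem eq_of_isMaximal_of_X_pow_mem (𝔪 𝔫 : Ideal U) [𝔪.IsMaximal] [𝔫.IsMaximal]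
    (hu : (⟨(X 0 : MvPolynomial (Fin 2) k) ^ n, X_pow_mem U hU 0⟩ : U) ∈ 𝔪)
    (hv : (⟨(X 1 : MvPolynomial (Fin 2) k) ^ n, X_pow_mem U hU 1⟩ : U) ∈ 𝔪)
    (hu' : (⟨(X 0 : MvPolynomial (Fin 2) k) ^ n, X_pow_mem U hU 0⟩ : U) ∈ 𝔫)
    (hv' : (⟨(X 1 : MvPolynomial (Fin 2) k) ^ n, X_pow_mem U hU 1⟩ : U) ∈ 𝔫) : 𝔫 = 𝔪 := by
  refine Ideal.IsMaximal.eq_of_le ‹𝔫.IsMaximal› (Ideal.IsMaximal.ne_top ‹_›) fun x hx => ?_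
  -- split off the constant term
  obtain ⟨c, hc⟩ : ∃ c : k, constantCoeff (x : MvPolynomial (Fin 2) k) = c := ⟨_, rfl⟩
  let xp : U := x - ⟨C c, C_mem U hU c⟩
  have hxp : constantCoeff (xp : MvPolynomial (Fin 2) k) = 0 := by
    simp only [xp, AddSubgroupClass.coe_sub, map_sub, constantCoeff_C, hc, sub_self]
  have hm : xp ∈ 𝔪 := mem_of_constantCoeff_eq_zero U hU 𝔪 hu hv xp hxp
  have hn : xp ∈ 𝔫 := mem_of_constantCoeff_eq_zero U hU 𝔫 hu' hv' xp hxp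
  by_cases hc0 : c = 0
  · have : x = xp := by
      apply Subtype.ext
      change (x : MvPolynomial (Fin 2) k) = (x : MvPolynomial (Fin 2) k) - C c
      rw [hc0, C_0, sub_zero]
    rw [this]; exact hm
  · -- `C c = x - xp ∈ 𝔫` is a unit: contradiction with `𝔫 ≠ ⊤`
    exfalso
    have hCmem : (⟨C c, C_mem U hU c⟩ : U) ∈ 𝔫 := by
      have : (⟨C c, C_mem U hU c⟩ : U) = x - xp := by simp [xp]
      rw [this]; exact 𝔫.sub_mem hx hn
    have hunit : IsUnit (⟨C c, C_mem U hU c⟩ : U) := by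
      refine isUnit_iff_exists_inv.mpr ⟨⟨C c⁻¹, C_mem U hU c⁻¹⟩, Subtype.ext ?_⟩
      change C c * C c⁻¹ = (1 : MvPolynomial (Fin 2) k)
      rw [← C_mul, mul_inv_cancel₀ hc0, C_1]
    exact Ideal.IsMaximal.ne_top ‹𝔫.IsMaximal› (Ideal.eq_top_of_isUnit_mem _ hCmem hunit)

include hU in
/-- **`U` is regular at every maximal ideal other than the vertex**: for a maximal `𝔪 ∋ uⁿ, vⁿ` and a maximal
`𝔫 ≠ 𝔪`, one of `uⁿ`, `vⁿ` avoids `𝔫`, so `U_𝔫` is regular. [OURS · cell decomp-res] -/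
theorem isRegularLocalRing_atPrime_of_ne_vertex (hq : q.Coprime n) (𝔪 : Ideal U) [𝔪.IsMaximal]
    (hu : (⟨(X 0 : MvPolynomial (Fin 2) k) ^ n, X_pow_mem U hU 0⟩ : U) ∈ 𝔪)
    (hv : (⟨(X 1 : MvPolynomial (Fin 2) k) ^ n, X_pow_mem U hU 1⟩ : U) ∈ 𝔪)
    (𝔫 : Ideal U) [𝔫.IsMaximal] (hne : 𝔫 ≠ 𝔪) : IsRegularLocalRing (Localization.AtPrime 𝔫) := by
  by_cases hu' : (⟨(X 0 : MvPolynomial (Fin 2) k) ^ n, X_pow_mem U hU 0⟩ : U) ∈ 𝔫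
  · by_cases hv' : (⟨(X 1 : MvPolynomial (Fin 2) k) ^ n, X_pow_mem U hU 1⟩ : U) ∈ 𝔫
    · exact absurd (eq_of_isMaximal_of_X_pow_mem U hU 𝔪 𝔫 hu hv hu' hv') hne
    · exact isRegularLocalRing_atPrime_of_X_one_pow_notMem U hU hq 𝔫 hv'
  · exact isRegularLocalRing_atPrime_of_X_zero_pow_notMem U hU hq 𝔫 hu'

/-! ## The local `Sat₄` theorem at the vertex, unconditional -/

include hU in
/-- **`Sat₄`, LEVELLED, WITH THE EXACT CENTRE, AT THE LOCAL RING OF THE VERTEX — UNCONDITIONAL.**  For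
`U = k[u,v]^{(n;1,q)}` (`gcd(q,n) = 1`, `k` ANY field, `p = char k ∣ n` allowed) and every maximal ideal `𝔪 ⊆ U`
containing `uⁿ` and `vⁿ` (the vertex): `caᵐ(U_𝔪) = ca⁴(U_𝔪)` for all `m ≥ 4`, `ca(U_𝔪) = ca⁴(U_𝔪)`,
`ca⁴(U_𝔪) = ca⁴(U)·U_𝔪`, and `x/1 ∈ ca(U_𝔪) ↔ x ∈ ca(U)` for every `x ∈ U`. [OURS · cell decomp-res] -/
theorem saturation_cyclicQuotient_atVertex (hq : q.Coprime n) (𝔪 : Ideal U) [𝔪.IsMaximal]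
    (hu : (⟨(X 0 : MvPolynomial (Fin 2) k) ^ n, X_pow_mem U hU 0⟩ : U) ∈ 𝔪)
    (hv : (⟨(X 1 : MvPolynomial (Fin 2) k) ^ n, X_pow_mem U hU 1⟩ : U) ∈ 𝔪) :
    (∀ m : ℕ, 4 ≤ m → cohomologyAnnihilatorOfDegree (Localization.AtPrime 𝔪) m =
        cohomologyAnnihilatorOfDegree (Localization.AtPrime 𝔪) 4) ∧
      cohomologyAnnihilator (Localization.AtPrime 𝔪) = cohomologyAnnihilatorOfDegree (Localization.AtPrime 𝔪) 4 ∧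
      cohomologyAnnihilatorOfDegree (Localization.AtPrime 𝔪) 4 =
        (cohomologyAnnihilatorOfDegree U 4).map (algebraMap U (Localization.AtPrime 𝔪)) ∧
      ∀ x : U, algebraMap U (Localization.AtPrime 𝔪) x ∈ cohomologyAnnihilator (Localization.AtPrime 𝔪) ↔
        x ∈ cohomologyAnnihilator U := by
  refine saturation_cyclicQuotient_atVertex_charFree U hU hq 𝔪 ?_
  intro 𝔫 _ hne
  exact isRegularLocalRing_atPrime_of_ne_vertex U hU hq 𝔪 hu hv 𝔫 hne

include hU in
/-- **At every ring RING-ISOMORPHIC to the local ring of the vertex**, unconditional: `e : T ≃+* U_𝔪` with `𝔪` the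
vertex ⇒ `caᵐ(T) = ca⁴(T)` (`m ≥ 4`) and `ca(T) = ca⁴(T)`. [OURS · cell decomp-res] -/
theorem saturation_of_ringEquiv_cyclicQuotient_vertex (hq : q.Coprime n) (𝔪 : Ideal U) [𝔪.IsMaximal]
    (hu : (⟨(X 0 : MvPolynomial (Fin 2) k) ^ n, X_pow_mem U hU 0⟩ : U) ∈ 𝔪)
    (hv : (⟨(X 1 : MvPolynomial (Fin 2) k) ^ n, X_pow_mem U hU 1⟩ : U) ∈ 𝔪)
    {T : Type u} [CommRing T] (e : T ≃+* Localization.AtPrime 𝔪) :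
    (∀ m : ℕ, 4 ≤ m → cohomologyAnnihilatorOfDegree T m = cohomologyAnnihilatorOfDegree T 4) ∧
      cohomologyAnnihilator T = cohomologyAnnihilatorOfDegree T 4 :=
  have h := saturation_cyclicQuotient_atVertex U hU hq 𝔪 hu hv
  levelledSaturation_of_ringEquiv e h.1 h.2.1

end Summit.ResolutionOfSingularities.ResolutionOfSingularities.Theorems.HomologicalConductor.PersistenceCyclicQuotientVertexIsolated

end
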